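import Summits.BirchSwinnertonDyer.BirchSwinnertonDyer.Theorems.ByReductionTypeAtTwoSupersingularTowerTorsionTwo
import Summits.BirchSwinnertonDyer.BirchSwinnertonDyer.Theorems.ByReductionTypeAtTwoSupersingularTwoAdicImageCriterion
import Summits.BirchSwinnertonDyer.BirchSwinnertonDyer.Theorems.TwoAdicConverseDyadicTypeTwistInvariant
import Summits.BirchSwinnertonDyer.Rank1Residual.GaloisImage.PadicSquareClass
import Literature.NumberTheory.EllipticCurves.TwoAdicImageSurjectivityModFourProofs
import Literature.NumberTheory.EllipticCurves.TwoAdicImageQuadraticTwistProofs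
import Literature.NumberTheory.EllipticCurves.IrreducibleModPQuadraticTwistProofs
import Literature.NumberTheory.EllipticCurves.ModTwoReducibleIffTwoTorsionRoot
import HarnessLib

/-!
# Route `TwoAdicConverse` (rung S3), item 19218 `GoodOrdinaryRankZeroTwoConverse` / crux 19556: at a prime of GOOD reduction
# `2`, ORDINARITY IS AUTOMATIC off the surjective-mod-`2` locus — `GoodOrd W 2` follows from good reduction alone whenever
# `E(ℚ)[2] ≠ 0` (stratum (β)), `Δ ∈ ℚ×²` (strata (γ₁) cubic image / full `2`-torsion), `Δ ∈ ℚ₂×²`, or `ψ₂²` has a `ℚ₂`-root;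
# equivalently good SUPERSINGULAR reduction at `2` forces `ρ̄_{E,2}` SURJECTIVE (unconditionally) and `Δ ∉ ℚ₂×²`

Cell `bsd-2adic`, seat `bsd-2adic-conv-1` (GEN 22). THEOREMS ONLY — no named fact, no definition, nothing conditional, no `sorry`.
HONEST FRAMING: bookkeeping on the leaf hypothesis `GoodOrd W 2` of the S3 items (19218 / 19556 / 19220) and of the 19556 lines
L1 `gv-mixed-descent-two` (habitat (β)) and L2 `f4-semisimple-cubic-two` (habitat (γ₁)); nothing about `λ`, Selmer groups or
`L`-values; items stay OPEN; BSD is not proved by any of this. PARTITION (D-0054): none — RANK axis (S3) × X5@2 good-ordinary vs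
good-supersingular rows; types-the-object-of (the off-habitat strata (β), (γ₁), (γ₂)∩{Δ ∈ ℚ₂×²} never meet a supersingular `2`).

**Mechanism (all inputs are tree theorems).** On the globally minimal model, good SUPERSINGULAR reduction at `2` (`GoodSS W 2`:
good, `a₂` even) means `a₁` even and `a₃` odd (`Supersingular.even_a₁_and_odd_a₃_of_goodSS_two`), hence
`Δ_min ≡ 5 (mod 8)` (`Supersingular.minimalDiscriminantInt_emod_eight_eq_five_of_goodSS_two`) — so `Δ` is not a `2`-ADIC square
(odd `2`-adic squares are `≡ 1 (mod 8)`, `GaloisImage.PadicSquareClass.emod_eight_eq_one_of_isSquare_padicTwo`), a fortiori not a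
rational square — and the `2`-division cubic `4x³ + b₂x² + 2b₄x + b₆` (`4 ∣ b₂`, `2 ∣ b₄`, `b₆` odd) has no `ℚ₂`-root
(`fourCubic_ne_zero_padic_two`; the height-`2` formal group has no `ℚ₂`-rational `2`-torsion), a fortiori no rational root
(`P2.irr_two_of_goodSS_two`); with Dokchitser–Dokchitser (1) as a tree theorem this is `ρ̄_{E,2}` onto `GL₂(𝔽₂)`
(`SSTwoAdicImage.hasSurjectiveModNGaloisRep_two_of_goodSS_two`, cited). Contrapositives (this file): good reduction at `2` + any of {rational `2`-torsion
abscissa, `Red W 2`, `¬ Surj W 2`, `Δ ∈ ℚ×²`, `Δ ∈ ℚ₂×²`, a `ℚ₂`-root of `ψ₂²`} ⇒ `GoodOrd W 2`. Since `E[2]` and the square class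
of `Δ` are quadratic-twist invariants, inside the twist family of such a curve EVERY twist with good reduction at `2` is ordinary at
`2` (§3, via `hasIrreducibleModPGaloisRep_iff_of_smul_eq_quadraticTwist`).

* §1 `not_isSquare_Δ_padic_two_of_goodSS_two`, `not_exists_padic_root_twoDivisionCubic_of_goodSS_two`;
* §2 `goodOrd_two_of_good_of_hasRationalTwoTorsionX / _of_red / _of_not_surj / _of_isSquare_Δ / _of_isSquare_Δ_padic /
  _of_exists_padic_root`, and `card_roots_twoTorsionPolynomial_padic_two_eq_three_of_good_of_isSquare` (L2 rung (1) with `GoodOrd`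
  DERIVED: good at `2` ∧ `Δ ∈ ℚ×²` ⇒ `E[2] ⊂ E(ℚ₂)`);
* §3 `goodOrd_two_quadraticTwist_of_good_of_hasRationalTwoTorsionX` / `…_of_isSquare_Δ_padic` (twist families on (β) /
  on `Δ ∈ ℚ₂×²`).

References: J. H. Silverman, *AEC* (2009) V.4, VII.2, App. A Prop. 1.1; T. Dokchitser, V. Dokchitser, Math. Z. 272 (2012) Thm (1);
J.-P. Serre, *A course in arithmetic* II §3.3. [SilvermanAEC2009] [DokchitserDokchitserMathZ2012] [Serre1973]
-/

set_option linter.dupNamespace false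
set_option autoImplicit false

noncomputable section

open scoped Classical
open Polynomial WeierstrassCurve Literature.NumberTheory.EllipticCurves Literature.NumberTheory.EllipticCurves.Greenberg1999
  Literature.NumberTheory.EllipticCurves.Rank1Residual Summit.BirchSwinnertonDyer.Rank1Residual

namespace Summit.BirchSwinnertonDyer.BirchSwinnertonDyer.Theorems.TwoAdicTwistConverse

variable (W : WeierstrassCurve ℚ) [W.IsElliptic] [W.IsGloballyMinimal]

/-! ## §1. Good supersingular reduction at `2`: `Δ ∉ ℚ₂×²`, no `ℚ₂`-rational `2`-torsion -/

omit [W.IsElliptic] in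
/-- **`GoodSS W 2 ⇒ Δ_W` is NOT a `2`-adic square**: `Δ_min ≡ 5 (mod 8)`, while an odd `2`-adic square is `≡ 1 (mod 8)`. Sharpens
P2's rational `not_isSquare_Δ_of_goodSS_two`. [cite: Serre1973, Ch. II §3.3 Thm 4] -/
theorem not_isSquare_Δ_padic_two_of_goodSS_two (h : GoodSS W 2) : ¬ IsSquare ((W.Δ : ℚ) : ℚ_[2]) := by
  have h5 := Supersingular.minimalDiscriminantInt_emod_eight_eq_five_of_goodSS_two W h
  have hodd : ¬ (2 : ℤ) ∣ minimalDiscriminantInt W := by omega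
  intro hsq
  rw [← cast_minimalDiscriminantInt W, Rat.cast_intCast] at hsq
  have h1 := GaloisImage.PadicSquareClass.emod_eight_eq_one_of_isSquare_padicTwo hodd hsq
  omega

omit [W.IsElliptic] in
/-- **`GoodSS W 2 ⇒` the `2`-division cubic `ψ₂² = 4x³ + b₂x² + 2b₄x + b₆` has NO root in `ℚ₂`** (`E(ℚ₂)[2] = 0`: `4 ∣ b₂`,
`2 ∣ b₄`, `b₆` odd on the minimal model; `fourCubic_ne_zero_padic_two`). [cite: SilvermanAEC2009, VII.2 and IV (formal group)] -/
theorem not_exists_padic_root_twoDivisionCubic_of_goodSS_two (h : GoodSS W 2) :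
    ¬ ∃ x : ℚ_[2], 4 * x ^ 3 + (W.b₂ : ℚ_[2]) * x ^ 2 + 2 * (W.b₄ : ℚ_[2]) * x + (W.b₆ : ℚ_[2]) = 0 := by
  rintro ⟨x, hx⟩
  obtain ⟨p2, p4, p6⟩ := P2.b_parity_of_goodSS_two W h
  obtain ⟨hb₂, hb₄, hb₆⟩ := b₂_b₄_b₆_eq_intCast W
  rw [hb₂, hb₄, hb₆] at hx
  push_cast at hx
  exact Summit.BirchSwinnertonDyer.BirchSwinnertonDyer.Theorems.SSFlatEC.fourCubic_ne_zero_padic_two p2 p4 p6 x hx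

/-! ## §2. Good reduction at `2`: ordinarity is automatic off the surjective locus -/

omit [W.IsElliptic] in
/-- Good reduction at `2` is ordinary or supersingular (by cases on the parity of `a₂`). [folklore] -/
theorem goodOrd_or_goodSS_of_good_two (hgood : W.HasGoodReductionAtPrime 2) : GoodOrd W 2 ∨ GoodSS W 2 := by
  by_cases h2 : (2 : ℤ) ∣ W.frobeniusTrace 2
  · exact Or.inr ⟨hgood, by exact_mod_cast h2⟩
  · exact Or.inl ⟨hgood, by exact_mod_cast h2⟩

/-- **Good at `2` ∧ `ρ̄_{E,2}` not surjective ⇒ good ORDINARY at `2`.** [cite: DokchitserDokchitserMathZ2012, Theorem (1)] -/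
theorem goodOrd_two_of_good_of_not_surj (hgood : W.HasGoodReductionAtPrime 2) (hns : ¬ W.HasSurjectiveModNGaloisRep 2) :
    GoodOrd W 2 := by
  rcases goodOrd_or_goodSS_of_good_two W hgood with hgo | hss
  · exact hgo
  · exact absurd (SSTwoAdicImage.hasSurjectiveModNGaloisRep_two_of_goodSS_two W hss) hns

/-- **Good at `2` ∧ `E[2]` reducible (`Red W 2`) ⇒ good ORDINARY at `2`** (stratum (β)). [cite: SilvermanAEC2009, VII.2] -/
theorem goodOrd_two_of_good_of_red (hgood : W.HasGoodReductionAtPrime 2) (hred : Red W 2) : GoodOrd W 2 := by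
  rcases goodOrd_or_goodSS_of_good_two W hgood with hgo | hss
  · exact hgo
  · exact absurd (P2.irr_two_of_goodSS_two W hss) hred

/-- **Good at `2` ∧ a rational `2`-torsion point (abscissa `x`) ⇒ good ORDINARY at `2`** — the L1 card's remark «good reduction
at `2` + rational `2`-torsion ⇒ ordinary» as a kernel theorem. [cite: SilvermanAEC2009, VII.2 and III.2.3] -/
theorem goodOrd_two_of_good_of_hasRationalTwoTorsionX (hgood : W.HasGoodReductionAtPrime 2) {x : ℚ}
    (hx : HasRationalTwoTorsionX W x) : GoodOrd W 2 := by
  refine goodOrd_two_of_good_of_red W hgood ?_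
  have hroot : W.twoTorsionPolynomial.toPoly.IsRoot x :=
    (isRoot_twoTorsionPolynomial_iff W x).mpr ((hasRationalTwoTorsionX_iff_twoDivision W x).mp hx)
  exact W.not_hasIrreducibleModPGaloisRep_two_of_isRoot_twoTorsionPolynomial hroot

omit [W.IsElliptic] in
/-- **Good at `2` ∧ `Δ ∈ ℚ₂×²` ⇒ good ORDINARY at `2`.** [cite: Serre1973, Ch. II §3.3 Thm 4] -/
theorem goodOrd_two_of_good_of_isSquare_Δ_padic (hgood : W.HasGoodReductionAtPrime 2)
    (hΔ : IsSquare ((W.Δ : ℚ) : ℚ_[2])) : GoodOrd W 2 := by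
  rcases goodOrd_or_goodSS_of_good_two W hgood with hgo | hss
  · exact hgo
  · exact absurd hΔ (not_isSquare_Δ_padic_two_of_goodSS_two W hss)

omit [W.IsElliptic] in
/-- **Good at `2` ∧ `Δ ∈ ℚ×²` ⇒ good ORDINARY at `2`** (strata (γ₁) cubic image, full rational `2`-torsion).
[cite: DokchitserDokchitserMathZ2012, Theorem (1)] -/
theorem goodOrd_two_of_good_of_isSquare_Δ (hgood : W.HasGoodReductionAtPrime 2) (hΔ : IsSquare W.Δ) : GoodOrd W 2 := by
  refine goodOrd_two_of_good_of_isSquare_Δ_padic W hgood ?_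
  obtain ⟨v, hv⟩ := hΔ
  exact ⟨(v : ℚ_[2]), by rw [hv]; push_cast; ring⟩

omit [W.IsElliptic] in
/-- **Good at `2` ∧ a `ℚ₂`-root of `ψ₂²` ⇒ good ORDINARY at `2`** (`E(ℚ₂)[2] ≠ 0` excludes the supersingular formal group).
[cite: SilvermanAEC2009, VII.2] -/
theorem goodOrd_two_of_good_of_exists_padic_root (hgood : W.HasGoodReductionAtPrime 2)
    (hx : ∃ x : ℚ_[2], 4 * x ^ 3 + (W.b₂ : ℚ_[2]) * x ^ 2 + 2 * (W.b₄ : ℚ_[2]) * x + (W.b₆ : ℚ_[2]) = 0) : GoodOrd W 2 := by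
  rcases goodOrd_or_goodSS_of_good_two W hgood with hgo | hss
  · exact hgo
  · exact absurd hx (not_exists_padic_root_twoDivisionCubic_of_goodSS_two W hss)

/-- **At a good `2` the three readings coincide: `GoodOrd W 2 ⟺ ψ₂²` has a `ℚ₂`-root** (⇒: GEN 21's Hensel root of valuation `−2`;
⇐: above). [cite: SilvermanAEC2009, VII.2–VII.3] -/
theorem goodOrd_two_iff_exists_padic_root_of_good (hgood : W.HasGoodReductionAtPrime 2) :
    GoodOrd W 2 ↔ ∃ x : ℚ_[2], 4 * x ^ 3 + (W.b₂ : ℚ_[2]) * x ^ 2 + 2 * (W.b₄ : ℚ_[2]) * x + (W.b₆ : ℚ_[2]) = 0 := by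
  refine ⟨fun hgo ↦ ?_, goodOrd_two_of_good_of_exists_padic_root W hgood⟩
  obtain ⟨x, hx, -⟩ := exists_padic_root_twoDivisionCubic_of_goodOrd_or_mult W (Or.inl hgo)
  exact ⟨x, hx⟩

/-- **L2 rung (1) with `GoodOrd` DERIVED: good reduction at `2` ∧ `Δ ∈ ℚ×²` ⇒ `E[2] ⊂ E(ℚ₂)`** (`ψ₂²` has `3` roots in `ℚ₂`;
GEN 21 `card_roots_twoTorsionPolynomial_padic_two_of_goodOrd_or_mult_of_isSquare` fed by §2). [cite: SilvermanAEC2009, VII.2] -/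
theorem card_roots_twoTorsionPolynomial_padic_two_eq_three_of_good_of_isSquare (hgood : W.HasGoodReductionAtPrime 2)
    (hΔ : IsSquare W.Δ) : Multiset.card ((W.twoTorsionPolynomial.toPoly).map (algebraMap ℚ ℚ_[2])).roots = 3 :=
  card_roots_twoTorsionPolynomial_padic_two_of_goodOrd_or_mult_of_isSquare W
    (Or.inl (goodOrd_two_of_good_of_isSquare_Δ W hgood hΔ)) hΔ

/-! ## §3. Twist families on stratum (β): every good-at-`2` twist is ordinary -/

omit [W.IsGloballyMinimal] in
/-- **On stratum (β) ordinarity propagates to every good-at-`2` quadratic twist**: if `W` has a rational `2`-torsion abscissa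
`x`, then for every `d ≠ 0` and every globally minimal model `V` of `W^{(d)}` (`C • V = W.quadraticTwist d`) with good reduction
at `2`, `GoodOrd V 2` — `E[2]` is reducible for `W`, and reducibility of `E[2]` is invariant under quadratic twist and change of
model (`hasIrreducibleModPGaloisRep_iff_of_smul_eq_quadraticTwist`). [cite: SilvermanAEC2009, X.5 Cor. 5.4 and III.2.3] -/
theorem goodOrd_two_quadraticTwist_of_good_of_hasRationalTwoTorsionX {x : ℚ} (hx : HasRationalTwoTorsionX W x) {d : ℚ}
    (hd : d ≠ 0) (V : WeierstrassCurve ℚ) [V.IsElliptic] [V.IsGloballyMinimal] {C : VariableChange ℚ}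
    (hC : C • V = W.quadraticTwist d) (hgood : V.HasGoodReductionAtPrime 2) : GoodOrd V 2 := by
  refine goodOrd_two_of_good_of_red V hgood ?_
  -- `E[2]` reducible for `W` (rational `2`-torsion), and reducibility is invariant under twist + change of model
  have hroot : W.twoTorsionPolynomial.toPoly.IsRoot x :=
    (isRoot_twoTorsionPolynomial_iff W x).mpr ((hasRationalTwoTorsionX_iff_twoDivision W x).mp hx)
  have hredW : ¬ W.HasIrreducibleModPGaloisRep 2 := W.not_hasIrreducibleModPGaloisRep_two_of_isRoot_twoTorsionPolynomial hroot
  intro hirrV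
  exact hredW ((WeierstrassCurve.hasIrreducibleModPGaloisRep_iff_of_smul_eq_quadraticTwist W V hd hC 2).mp hirrV)

omit [W.IsElliptic] [W.IsGloballyMinimal] in
/-- **On the locus `Δ ∈ ℚ₂×²` ordinarity propagates to every good-at-`2` quadratic twist** (the `2`-adic square class of `Δ` is a
twist invariant, GEN 21 `isSquare_padic_Δ_smul_quadraticTwist_iff`): for `d ≠ 0` and any model `V` of `W^{(d)}`
(`C • V = W.quadraticTwist d`), globally minimal with good reduction at `2`, `GoodOrd V 2`. Covers (γ₁), full `2`-torsion and
(γ₂)∩{Δ ∈ ℚ₂×²} twist families. [cite: SilvermanAEC2009, X.5 Cor. 5.4] -/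
theorem goodOrd_two_quadraticTwist_of_good_of_isSquare_Δ_padic (hΔ : IsSquare ((W.Δ : ℚ) : ℚ_[2])) {d : ℚ} (hd : d ≠ 0)
    (V : WeierstrassCurve ℚ) [V.IsGloballyMinimal] {C : VariableChange ℚ} (hC : C • V = W.quadraticTwist d)
    (hgood : V.HasGoodReductionAtPrime 2) : GoodOrd V 2 := by
  haveI : Fact (Nat.Prime 2) := ⟨Nat.prime_two⟩
  have hA : C⁻¹ • W.quadraticTwist d = V := by rw [← hC, inv_smul_smul]
  exact goodOrd_two_of_good_of_isSquare_Δ_padic V hgood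
    ((isSquare_padic_Δ_smul_quadraticTwist_iff 2 W V hd hA).mpr hΔ)

end Summit.BirchSwinnertonDyer.BirchSwinnertonDyer.Theorems.TwoAdicTwistConverse

end
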